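import Mathlib

/-!
# Oriented SDPP gadgets: constant-composition powers satisfy the simultaneous double product property

(solo-blind seat, s58; the combinatorial core of "Prop A" in the seat's note `work/sdpp58/GADGET.md`.)

Let `G` be an additive commutative group and `(P s, Q s)_{s : ι}` a family of pairs of subsets indexed by a
linear order, with a set `D` containing all own differences `Q s - P s` and avoiding all upper cross
differences `Q s - P s'` for `s < s'` (an *oriented SDPP gadget*; each pair is moreover assumed to have the
double product property).  For words `w : Fin k → ι` put `A_w = ∏_c P (w c)` and `B_w = ∏_c Q (w c)` inside
`Fin k → G`.  We prove:

* `soloSdpp_exists_lt_of_perm` : two distinct words that are rearrangements of each other have a coordinate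
  `c` with `κ c < i c` (and, by symmetry, one with `i c < κ c`) — the "transitive tournament has full Sperner
  capacity" step;
* `soloSdpp_power_cross` : for words `i, j, κ` with `κ` a rearrangement of `i`, elements `a ∈ A_i`, `a' ∈ A_j`,
  `b ∈ B_j`, `b' ∈ B_κ` with `a - a' + b - b' = 0` force `i = κ` — this is condition (ii) of the simultaneous
  double product property of Cohn–Kleinberg–Szegedy–Umans (FOCS 2005, Definition 20, written additively) for
  the family of all words of one fixed composition;
* `soloSdpp_power_dpp` : each pair `(A_w, B_w)` has the double product property.

Hence (CKSU05 Theorem 23, abelian case, applied in `G^k` and optimised over compositions) an oriented gadget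
with `∑_s (|P s| |Q s|)^{ω/2} = |G|^{3/2}` bounds the exponent of matrix multiplication by `ω`; that analytic
step is literature and is not formalised here.
-/

namespace Summit.MatrixMultiplication.MatrixMultiplication.Theorems

open Finset

section Words

variable {ι : Type*} [LinearOrder ι] {k : ℕ}

/-- Two distinct words that are rearrangements of each other differ "downwards" in some coordinate. -/
theorem soloSdpp_exists_lt_of_perm (i κ : Fin k → ι) (σ : Equiv.Perm (Fin k))
    (hperm : ∀ c, κ c = i (σ c)) (hne : i ≠ κ) : ∃ c, κ c < i c := by
  by_contra h
  have h' : ∀ c, i c ≤ κ c := fun c => not_lt.mp (fun hlt => h ⟨c, hlt⟩)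
  apply hne
  have key : ∀ t : ι,
      (Finset.univ.filter (fun c => t ≤ i c)) = (Finset.univ.filter (fun c => t ≤ κ c)) := by
    intro t
    apply Finset.eq_of_subset_of_card_le
    · intro c hc
      simp only [Finset.mem_filter, Finset.mem_univ, true_and] at hc ⊢
      exact le_trans hc (h' c)
    · have hmap : (Finset.univ.filter (fun c => t ≤ κ c))
          = (Finset.univ.filter (fun d => t ≤ i d)).map σ.symm.toEmbedding := by
        ext c
        simp [Finset.mem_map_equiv, hperm]
      rw [hmap, Finset.card_map]
  funext c
  have hc : c ∈ Finset.univ.filter (fun d => κ c ≤ κ d) := by simp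
  rw [← key (κ c)] at hc
  simp only [Finset.mem_filter, Finset.mem_univ, true_and] at hc
  exact le_antisymm (h' c) hc

/-- The symmetric form: some coordinate goes strictly up as well. -/
theorem soloSdpp_exists_gt_of_perm (i κ : Fin k → ι) (σ : Equiv.Perm (Fin k))
    (hperm : ∀ c, κ c = i (σ c)) (hne : i ≠ κ) : ∃ c, i c < κ c := by
  have hperm' : ∀ c, i c = κ (σ.symm c) := fun c => by simp [hperm]
  exact soloSdpp_exists_lt_of_perm κ i σ.symm hperm' (Ne.symm hne)

end Words

section Gadget

variable {G : Type*} [AddCommGroup G] {ι : Type*} [LinearOrder ι] {k : ℕ}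

/-- **SDPP condition (ii) for constant-composition powers of an oriented gadget.**  If all own differences
`Q t - P t` lie in `D` and all upper cross differences `Q s - P s'` (`s < s'`) avoid `D`, then for words
`i, j, κ` with `κ` a rearrangement of `i` and `a ∈ A_i, a' ∈ A_j, b ∈ B_j, b' ∈ B_κ`,
`a - a' + b - b' = 0` forces `i = κ`. -/
theorem soloSdpp_power_cross (P Q : ι → Set G) (D : Set G)
    (hown : ∀ t, ∀ p ∈ P t, ∀ q ∈ Q t, q - p ∈ D)
    (hcross : ∀ s s', s < s' → ∀ p ∈ P s', ∀ q ∈ Q s, q - p ∉ D)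
    (i j κ : Fin k → ι) (σ : Equiv.Perm (Fin k)) (hperm : ∀ c, κ c = i (σ c))
    (a a' b b' : Fin k → G)
    (ha : ∀ c, a c ∈ P (i c)) (ha' : ∀ c, a' c ∈ P (j c))
    (hb : ∀ c, b c ∈ Q (j c)) (hb' : ∀ c, b' c ∈ Q (κ c))
    (h : a - a' + b - b' = 0) : i = κ := by
  by_contra hne
  obtain ⟨c, hc⟩ := soloSdpp_exists_lt_of_perm i κ σ hperm hne
  have h0 : a c - a' c + b c - b' c = 0 := by simpa using congrFun h c
  have hc' : b c - a' c = b' c - a c := by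
    rw [← sub_eq_zero]
    have e : b c - a' c - (b' c - a c) = a c - a' c + b c - b' c := by abel
    rw [e]; exact h0
  have hin : b c - a' c ∈ D := hown (j c) (a' c) (ha' c) (b c) (hb c)
  rw [hc'] at hin
  exact hcross (κ c) (i c) hc (a c) (ha c) (b' c) (hb' c) hin

/-- The two-pair gadget of CKSU05 Proposition 24 in any nontrivial additive group, in oriented form:
bottom `(G ∖ {0}, {0})`, top `({0}, G ∖ {0})`, `D = G ∖ {0}`; the own differences lie in `D` and the
single upper cross difference `0 - 0` avoids it. -/
theorem soloSdpp_cksu_two_pair (g : G) :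
    (∀ p ∈ ({x : G | x ≠ 0}), ∀ q ∈ ({0} : Set G), q - p ∈ {x : G | x ≠ 0}) ∧
    (∀ p ∈ ({0} : Set G), ∀ q ∈ ({x : G | x ≠ 0}), q - p ∈ {x : G | x ≠ 0}) ∧
    (∀ p ∈ ({0} : Set G), ∀ q ∈ ({0} : Set G), q - p ∉ {x : G | x ≠ 0}) ∧ (g - g ∉ {x : G | x ≠ 0}) := by
  refine ⟨?_, ?_, ?_, ?_⟩
  · intro p hp q hq
    simp only [Set.mem_singleton_iff] at hq
    simp only [Set.mem_setOf_eq] at hp ⊢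
    rw [hq, zero_sub, neg_ne_zero]; exact hp
  · intro p hp q hq
    simp only [Set.mem_singleton_iff] at hp
    simp only [Set.mem_setOf_eq] at hq ⊢
    rw [hp, sub_zero]; exact hq
  · intro p hp q hq
    simp only [Set.mem_singleton_iff] at hp hq
    simp [hp, hq]
  · simp

end Gadget

section Dpp

variable {G : Type*} [AddCommGroup G] {ι : Type*} {k : ℕ}

/-- **SDPP condition (i) for powers.**  The double product property is inherited coordinatewise by the word
products `(A_w, B_w)`. -/
theorem soloSdpp_power_dpp (P Q : ι → Set G)
    (hdpp : ∀ s, ∀ p ∈ P s, ∀ p' ∈ P s, ∀ q ∈ Q s, ∀ q' ∈ Q s, q - p = q' - p' → p = p' ∧ q = q')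
    (w : Fin k → ι) (a a' b b' : Fin k → G)
    (ha : ∀ c, a c ∈ P (w c)) (ha' : ∀ c, a' c ∈ P (w c))
    (hb : ∀ c, b c ∈ Q (w c)) (hb' : ∀ c, b' c ∈ Q (w c))
    (h : b - a = b' - a') : a = a' ∧ b = b' := by
  have hc : ∀ c, a c = a' c ∧ b c = b' c := fun c =>
    hdpp (w c) (a c) (ha c) (a' c) (ha' c) (b c) (hb c) (b' c) (hb' c) (by simpa using congrFun h c)
  exact ⟨funext fun c => (hc c).1, funext fun c => (hc c).2⟩

end Dpp

end Summit.MatrixMultiplication.MatrixMultiplication.Theorems
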